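import Summits.QuantumFields.YangMills.Theses.FradkinShenkerFlow
import Literature.MathematicalPhysics.QuantumFieldTheory.LatticeGaugeDobrushinPoincare
import Literature.MathematicalPhysics.QuantumFieldTheory.LatticeGaugeProofs

/-!
# Mixed Lipschitz bound for the Wilson action on the torus

Lattice-side helper for `StrongPinningPoincare`: the interaction between two links `i ≠ j` in
the Wilson action is controlled by a **mixed (double-difference) Lipschitz bound**
`|S(x'[i↦g]) − S(x[i↦g]) − S(x'[i↦g']) + S(x[i↦g'])| ≤ √N · m(i,j) · ‖ρ(x_j) − ρ(a)‖_F · ‖ρ g − ρ g'‖_F`,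
`x' = x[j↦a]`, where `m(i,j) = ∑ₚ nᵢ(p) nⱼ(p)` counts slot incidences of the two links in
plaquettes (`∑ᵢ m(i,j) ≤ 64` in four dimensions, uniformly in the volume, including the
degenerate tori of side `1`). The matrix input is a double-difference estimate for products of
unitaries (`frobNorm_prod_dd_le`).
-/

noncomputable section

open MeasureTheory Function Real
open scoped Matrix
open Literature.MathematicalPhysics.QuantumFieldTheory

namespace Summit.QuantumFields.YangMills.Theorems.StrongPinningPoincare

namespace Lattice

/-! ### Matrix toolkit: differences and double differences of products of unitaries -/

section Matrices

variable {n : Type*} [Fintype n] [DecidableEq n]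

section LocalNorm

attribute [local instance] Matrix.frobeniusSeminormedAddCommGroup Matrix.frobeniusNormedAddCommGroup
  Matrix.frobeniusNormedSpace Matrix.frobeniusNormedRing Matrix.frobeniusNormedAlgebra

/-- Submultiplicativity `‖A B‖_F ≤ ‖A‖_F ‖B‖_F`. [folklore] -/
theorem frobNorm_mul_le (A B : Matrix n n ℂ) : frobNorm (A * B) ≤ frobNorm A * frobNorm B := by
  simp only [frobNorm_eq_norm]; exact norm_mul_le A B

end LocalNorm

/-- `|Re tr M| ≤ √n ‖M‖_F`. [folklore] -/
theorem abs_re_trace_le (M : Matrix n n ℂ) :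
    |M.trace.re| ≤ Real.sqrt (Fintype.card n) * frobNorm M := by
  have h := abs_re_trace_mul_le (1 : Matrix n n ℂ) M
  rw [Matrix.one_mul] at h
  have h1 : frobNorm (1 : Matrix n n ℂ) = Real.sqrt (Fintype.card n) := by
    rw [← frobNorm_sq_of_mem_unitaryGroup (Submonoid.one_mem _), Real.sqrt_sq (frobNorm_nonneg _)]
  rwa [h1] at h

/-- A product of unitaries is unitary. [folklore] -/
theorem listProd_ofFn_mem_unitaryGroup {m : ℕ} {U : Fin m → Matrix n n ℂ}
    (hU : ∀ k, U k ∈ Matrix.unitaryGroup n ℂ) : (List.ofFn U).prod ∈ Matrix.unitaryGroup n ℂ :=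
  list_prod_mem fun x hx => by
    obtain ⟨k, rfl⟩ := (List.mem_ofFn' U x).1 hx
    exact hU k

/-- **Single differences of products of unitaries**:
`‖∏ U_k − ∏ V_k‖_F ≤ ∑_k ‖U_k − V_k‖_F`. [folklore] -/
theorem frobNorm_prod_sub_le (m : ℕ) : ∀ (U V : Fin m → Matrix n n ℂ),
    (∀ k, U k ∈ Matrix.unitaryGroup n ℂ) → (∀ k, V k ∈ Matrix.unitaryGroup n ℂ) →
    frobNorm ((List.ofFn U).prod - (List.ofFn V).prod) ≤ ∑ k, frobNorm (U k - V k) := by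
  induction m with
  | zero => intro U V _ _; simp [frobNorm_zero]
  | succ m ihm =>
    intro U V hU hV
    rw [List.ofFn_succ, List.ofFn_succ, List.prod_cons, List.prod_cons, Fin.sum_univ_succ]
    set X := (List.ofFn fun k : Fin m => U k.succ).prod with hX
    set Y := (List.ofFn fun k : Fin m => V k.succ).prod with hY
    have hYu : Y ∈ Matrix.unitaryGroup n ℂ := listProd_ofFn_mem_unitaryGroup fun k => hV k.succ
    have ih := ihm (fun k => U k.succ) (fun k => V k.succ) (fun k => hU k.succ) fun k => hV k.succ
    have hsplit : U 0 * X - V 0 * Y = U 0 * (X - Y) + (U 0 - V 0) * Y := by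
      simp only [mul_sub, sub_mul]; abel
    rw [hsplit]
    calc frobNorm (U 0 * (X - Y) + (U 0 - V 0) * Y)
        ≤ frobNorm (U 0 * (X - Y)) + frobNorm ((U 0 - V 0) * Y) := frobNorm_add_le _ _
      _ = frobNorm (X - Y) + frobNorm (U 0 - V 0) := by
          rw [frobNorm_unitary_mul (hU 0), frobNorm_mul_unitary _ hYu]
      _ ≤ (∑ k : Fin m, frobNorm (U k.succ - V k.succ)) + frobNorm (U 0 - V 0) :=
          add_le_add ih le_rfl
      _ = frobNorm (U 0 - V 0) + ∑ k : Fin m, frobNorm (U k.succ - V k.succ) := add_comm _ _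

/-- **Double differences of products of unitaries**. Four families `P, Q, R, T` of unitaries
(slot values of one plaquette word in the configurations `(g,a), (g,b), (g',a), (g',b)`) such
that every slot is blind to one of the two variations (`P k = Q k ∧ R k = T k`, or
`P k = R k ∧ Q k = T k`) satisfy
`‖∏P − ∏Q − ∏R + ∏T‖_F ≤ (∑_k ‖P k − R k‖_F)(∑_k ‖P k − Q k‖_F)`. [folklore] -/
theorem frobNorm_prod_dd_le (m : ℕ) : ∀ (P Q R T : Fin m → Matrix n n ℂ),
    (∀ k, P k ∈ Matrix.unitaryGroup n ℂ) → (∀ k, Q k ∈ Matrix.unitaryGroup n ℂ) →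
    (∀ k, R k ∈ Matrix.unitaryGroup n ℂ) → (∀ k, T k ∈ Matrix.unitaryGroup n ℂ) →
    (∀ k, (P k = Q k ∧ R k = T k) ∨ (P k = R k ∧ Q k = T k)) →
    frobNorm ((List.ofFn P).prod - (List.ofFn Q).prod - (List.ofFn R).prod + (List.ofFn T).prod) ≤
      (∑ k, frobNorm (P k - R k)) * ∑ k, frobNorm (P k - Q k) := by
  induction m with
  | zero => intro P Q R T _ _ _ _ _; simp [frobNorm_zero]
  | succ m ihm =>
    intro P Q R T hP hQ hR hT hslot
    -- per-slot consequences of blindness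
    have hRT : ∀ k, frobNorm (R k - T k) = frobNorm (P k - Q k) := fun k => by
      rcases hslot k with ⟨h1, h2⟩ | ⟨h1, h2⟩
      · rw [h1, h2, sub_self, sub_self]
      · rw [h1, h2]
    have hQT : ∀ k, frobNorm (Q k - T k) = frobNorm (P k - R k) := fun k => by
      rcases hslot k with ⟨h1, h2⟩ | ⟨h1, h2⟩
      · rw [h1, h2]
      · rw [h1, h2, sub_self, sub_self]
    rw [List.ofFn_succ, List.ofFn_succ, List.ofFn_succ, List.ofFn_succ, List.prod_cons,
      List.prod_cons, List.prod_cons, List.prod_cons, Fin.sum_univ_succ, Fin.sum_univ_succ]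
    set BP := (List.ofFn fun k : Fin m => P k.succ).prod with hBP
    set BQ := (List.ofFn fun k : Fin m => Q k.succ).prod with hBQ
    set BR := (List.ofFn fun k : Fin m => R k.succ).prod with hBR
    set BT := (List.ofFn fun k : Fin m => T k.succ).prod with hBT
    have ih := ihm (fun k => P k.succ) (fun k => Q k.succ) (fun k => R k.succ)
      (fun k => T k.succ) (fun k => hP _) (fun k => hQ _) (fun k => hR _) (fun k => hT _)
      fun k => hslot _
    have hSi : 0 ≤ ∑ k : Fin m, frobNorm (P k.succ - R k.succ) :=
      Finset.sum_nonneg fun k _ => frobNorm_nonneg _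
    have hSj : 0 ≤ ∑ k : Fin m, frobNorm (P k.succ - Q k.succ) :=
      Finset.sum_nonneg fun k _ => frobNorm_nonneg _
    have h0i := frobNorm_nonneg (P 0 - R 0)
    have h0j := frobNorm_nonneg (P 0 - Q 0)
    rcases hslot 0 with ⟨h1, h2⟩ | ⟨h1, h2⟩
    · -- slot `0` is blind to the `j`-variation
      have hsplit : P 0 * BP - Q 0 * BQ - R 0 * BR + T 0 * BT =
          P 0 * (BP - BQ - BR + BT) + (P 0 - R 0) * (BR - BT) := by
        rw [← h1, ← h2]; simp only [mul_sub, mul_add, sub_mul]; abel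
      rw [hsplit]
      have hBRT : frobNorm (BR - BT) ≤ ∑ k : Fin m, frobNorm (P k.succ - Q k.succ) := by
        refine (frobNorm_prod_sub_le m _ _ (fun k => hR _) fun k => hT _).trans ?_
        exact le_of_eq (Finset.sum_congr rfl fun k _ => hRT _)
      calc frobNorm (P 0 * (BP - BQ - BR + BT) + (P 0 - R 0) * (BR - BT))
          ≤ frobNorm (P 0 * (BP - BQ - BR + BT)) + frobNorm ((P 0 - R 0) * (BR - BT)) :=
            frobNorm_add_le _ _
        _ ≤ frobNorm (BP - BQ - BR + BT) + frobNorm (P 0 - R 0) * frobNorm (BR - BT) := by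
            rw [frobNorm_unitary_mul (hP 0)]
            exact add_le_add le_rfl (frobNorm_mul_le _ _)
        _ ≤ (∑ k : Fin m, frobNorm (P k.succ - R k.succ)) * (∑ k : Fin m, frobNorm (P k.succ - Q k.succ))
            + frobNorm (P 0 - R 0) * ∑ k : Fin m, frobNorm (P k.succ - Q k.succ) :=
            add_le_add ih (mul_le_mul_of_nonneg_left hBRT h0i)
        _ ≤ (frobNorm (P 0 - R 0) + ∑ k : Fin m, frobNorm (P k.succ - R k.succ)) *
            (frobNorm (P 0 - Q 0) + ∑ k : Fin m, frobNorm (P k.succ - Q k.succ)) := by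
            nlinarith
    · -- slot `0` is blind to the `i`-variation
      have hsplit : P 0 * BP - Q 0 * BQ - R 0 * BR + T 0 * BT =
          P 0 * (BP - BQ - BR + BT) + (P 0 - Q 0) * (BQ - BT) := by
        rw [← h1, ← h2]; simp only [mul_sub, mul_add, sub_mul]; abel
      rw [hsplit]
      have hBQT : frobNorm (BQ - BT) ≤ ∑ k : Fin m, frobNorm (P k.succ - R k.succ) := by
        refine (frobNorm_prod_sub_le m _ _ (fun k => hQ _) fun k => hT _).trans ?_
        exact le_of_eq (Finset.sum_congr rfl fun k _ => hQT _)
      calc frobNorm (P 0 * (BP - BQ - BR + BT) + (P 0 - Q 0) * (BQ - BT))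
          ≤ frobNorm (P 0 * (BP - BQ - BR + BT)) + frobNorm ((P 0 - Q 0) * (BQ - BT)) :=
            frobNorm_add_le _ _
        _ ≤ frobNorm (BP - BQ - BR + BT) + frobNorm (P 0 - Q 0) * frobNorm (BQ - BT) := by
            rw [frobNorm_unitary_mul (hP 0)]
            exact add_le_add le_rfl (frobNorm_mul_le _ _)
        _ ≤ (∑ k : Fin m, frobNorm (P k.succ - R k.succ)) * (∑ k : Fin m, frobNorm (P k.succ - Q k.succ))
            + frobNorm (P 0 - Q 0) * ∑ k : Fin m, frobNorm (P k.succ - R k.succ) :=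
            add_le_add ih (mul_le_mul_of_nonneg_left hBQT h0j)
        _ ≤ (frobNorm (P 0 - R 0) + ∑ k : Fin m, frobNorm (P k.succ - R k.succ)) *
            (frobNorm (P 0 - Q 0) + ∑ k : Fin m, frobNorm (P k.succ - Q k.succ)) := by
            nlinarith

end Matrices

/-! ### Words of length four in a representation: the mixed Lipschitz bound -/

section Words

variable {ι : Type*} [DecidableEq ι] {N : ℕ} {G : Type*} [Group G]
  (ρ : G →* Matrix (Fin N) (Fin N) ℂ)

/-- The four slot matrices `ρ(v₀), ρ(v₁), ρ(v₂)ᴴ, ρ(v₃)ᴴ` of a plaquette-type word multiply to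
`ρ(v₀) ρ(v₁) ρ(v₂)ᴴ ρ(v₃)ᴴ`. [folklore] -/
theorem listProd_slots (v : Fin 4 → G) :
    (List.ofFn (![ρ (v 0), ρ (v 1), (ρ (v 2))ᴴ, (ρ (v 3))ᴴ] : Fin 4 → Matrix (Fin N) (Fin N) ℂ)).prod
      = ρ (v 0) * ρ (v 1) * (ρ (v 2))ᴴ * (ρ (v 3))ᴴ := by
  simp [List.ofFn_succ, mul_assoc]

/-- **Mixed Lipschitz bound for one word**: for links `i ≠ j`, a background `x`, and the four
configurations `x[j↦a][i↦g], x[i↦g], x[j↦a][i↦g'], x[i↦g']`, the double difference of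
`Re tr(ρ(W e₀) ρ(W e₁) ρ(W e₂)ᴴ ρ(W e₃)ᴴ)` is at most
`√N · (nᵢ ‖ρ g − ρ g'‖_F) · (nⱼ ‖ρ(x j) − ρ a‖_F)`, `nᵢ = #{k : e k = i}` (slot multiplicities;
`frobNorm_prod_dd_le` applied to the slot matrices). [folklore] -/
theorem abs_dd_word_le (hρu : ∀ g, ρ g ∈ Matrix.unitaryGroup (Fin N) ℂ) (e : Fin 4 → ι)
    (x : ι → G) {i j : ι} (hij : i ≠ j) (a g g' : G) :
    |(ρ (update (update x j a) i g (e 0)) * ρ (update (update x j a) i g (e 1)) *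
          (ρ (update (update x j a) i g (e 2)))ᴴ * (ρ (update (update x j a) i g (e 3)))ᴴ).trace.re -
        (ρ (update x i g (e 0)) * ρ (update x i g (e 1)) *
          (ρ (update x i g (e 2)))ᴴ * (ρ (update x i g (e 3)))ᴴ).trace.re -
        (ρ (update (update x j a) i g' (e 0)) * ρ (update (update x j a) i g' (e 1)) *
          (ρ (update (update x j a) i g' (e 2)))ᴴ * (ρ (update (update x j a) i g' (e 3)))ᴴ).trace.re +
        (ρ (update x i g' (e 0)) * ρ (update x i g' (e 1)) *
          (ρ (update x i g' (e 2)))ᴴ * (ρ (update x i g' (e 3)))ᴴ).trace.re|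
      ≤ Real.sqrt N * ((∑ k : Fin 4, if e k = i then (1 : ℝ) else 0) * frobNorm (ρ g - ρ g')) *
        ((∑ k : Fin 4, if e k = j then (1 : ℝ) else 0) * frobNorm (ρ (x j) - ρ a)) := by
  classical
  -- slot matrices
  set S : (Fin 4 → G) → Fin 4 → Matrix (Fin N) (Fin N) ℂ :=
    fun v => ![ρ (v 0), ρ (v 1), (ρ (v 2))ᴴ, (ρ (v 3))ᴴ] with hS
  have hcT : ∀ u : G, (ρ u)ᴴ ∈ Matrix.unitaryGroup (Fin N) ℂ := fun u => by
    have h := Unitary.star_mem (hρu u)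
    rwa [Matrix.star_eq_conjTranspose] at h
  have hSu : ∀ v k, S v k ∈ Matrix.unitaryGroup (Fin N) ℂ := fun v k => by
    fin_cases k
    · exact hρu _
    · exact hρu _
    · exact hcT _
    · exact hcT _
  have hSdep : ∀ (v w : Fin 4 → G) (k : Fin 4), v k = w k → S v k = S w k := by
    intro v w k h
    fin_cases k <;> simp [hS] at h ⊢ <;> simp [h]
  have hSdist : ∀ (v w : Fin 4 → G) (k : Fin 4),
      frobNorm (S v k - S w k) = frobNorm (ρ (v k) - ρ (w k)) := by
    intro v w k
    fin_cases k <;> simp [hS, ← Matrix.conjTranspose_sub, frobNorm_conjTranspose]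
  -- the four value vectors and their products
  set v1 : Fin 4 → G := fun k => update (update x j a) i g (e k) with hv1
  set v2 : Fin 4 → G := fun k => update x i g (e k) with hv2
  set v3 : Fin 4 → G := fun k => update (update x j a) i g' (e k) with hv3
  set v4 : Fin 4 → G := fun k => update x i g' (e k) with hv4
  have hP1 := listProd_slots ρ v1
  have hP2 := listProd_slots ρ v2
  have hP3 := listProd_slots ρ v3
  have hP4 := listProd_slots ρ v4
  simp only [hv1, hv2, hv3, hv4] at hP1 hP2 hP3 hP4
  rw [← hP1, ← hP2, ← hP3, ← hP4, ← Complex.sub_re, ← Complex.sub_re, ← Complex.add_re,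
    ← Matrix.trace_sub, ← Matrix.trace_sub, ← Matrix.trace_add]
  -- values of the four configurations at the slots
  have hval1 : ∀ k, v1 k = if e k = i then g else if e k = j then a else x (e k) := fun k => by
    simp only [hv1, update_apply]
  have hval2 : ∀ k, v2 k = if e k = i then g else x (e k) := fun k => by
    simp only [hv2, update_apply]
  have hval3 : ∀ k, v3 k = if e k = i then g' else if e k = j then a else x (e k) := fun k => by
    simp only [hv3, update_apply]
  have hval4 : ∀ k, v4 k = if e k = i then g' else x (e k) := fun k => by
    simp only [hv4, update_apply]
  -- blindness of every slot
  have hslot : ∀ k, (S v1 k = S v2 k ∧ S v3 k = S v4 k) ∨ (S v1 k = S v3 k ∧ S v2 k = S v4 k) := by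
    intro k
    by_cases hkj : e k = j
    · have hki : e k ≠ i := fun h => hij (h.symm.trans hkj)
      right
      refine ⟨hSdep _ _ k ?_, hSdep _ _ k ?_⟩
      · rw [hval1, hval3]; simp [hki]
      · rw [hval2, hval4]; simp [hki]
    · left
      refine ⟨hSdep _ _ k ?_, hSdep _ _ k ?_⟩
      · rw [hval1, hval2]; simp [hkj]
      · rw [hval3, hval4]; simp [hkj]
  -- the two difference sums
  have hdi : ∀ k, frobNorm (S v1 k - S v3 k) =
      (if e k = i then (1 : ℝ) else 0) * frobNorm (ρ g - ρ g') := fun k => by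
    rw [hSdist, hval1, hval3]
    by_cases hki : e k = i
    · simp [hki]
    · simp [hki, frobNorm_zero]
  have hdj : ∀ k, frobNorm (S v1 k - S v2 k) =
      (if e k = j then (1 : ℝ) else 0) * frobNorm (ρ (x j) - ρ a) := fun k => by
    rw [hSdist, hval1, hval2]
    by_cases hkj : e k = j
    · have hki : e k ≠ i := fun h => hij (h.symm.trans hkj)
      simp [hkj, Ne.symm hij, frobNorm_sub_comm (ρ a)]
    · by_cases hki : e k = i
      · simp [hki, hij, frobNorm_zero]
      · simp [hki, hkj, frobNorm_zero]
  have hsumi : ∑ k, frobNorm (S v1 k - S v3 k) =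
      (∑ k : Fin 4, if e k = i then (1 : ℝ) else 0) * frobNorm (ρ g - ρ g') := by
    rw [Finset.sum_mul]; exact Finset.sum_congr rfl fun k _ => hdi k
  have hsumj : ∑ k, frobNorm (S v1 k - S v2 k) =
      (∑ k : Fin 4, if e k = j then (1 : ℝ) else 0) * frobNorm (ρ (x j) - ρ a) := by
    rw [Finset.sum_mul]; exact Finset.sum_congr rfl fun k _ => hdj k
  -- conclude
  have hdd := frobNorm_prod_dd_le 4 (S v1) (S v2) (S v3) (S v4) (hSu _) (hSu _) (hSu _) (hSu _) hslot
  rw [hsumi, hsumj] at hdd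
  refine (abs_re_trace_le _).trans ?_
  rw [Fintype.card_fin, mul_assoc]
  exact mul_le_mul_of_nonneg_left hdd (Real.sqrt_nonneg _)

/-- **Mixed Lipschitz bound for a sum of words** (`W ↦ ∑ₚ (c − Re tr word_p(W))`): the
double difference over the two links is at most
`√N ‖ρ g − ρ g'‖_F ‖ρ(x j) − ρ a‖_F ∑ₚ nᵢ(p) nⱼ(p)`. [folklore] -/
theorem abs_dd_energy_le {Λ : Type*} [Fintype Λ] (hρu : ∀ g, ρ g ∈ Matrix.unitaryGroup (Fin N) ℂ)
    (E : Λ → Fin 4 → ι) (c : ℝ) (x : ι → G) {i j : ι} (hij : i ≠ j) (a g g' : G) :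
    |(∑ p, (c - (ρ (update (update x j a) i g (E p 0)) * ρ (update (update x j a) i g (E p 1)) *
          (ρ (update (update x j a) i g (E p 2)))ᴴ * (ρ (update (update x j a) i g (E p 3)))ᴴ).trace.re)) -
      (∑ p, (c - (ρ (update x i g (E p 0)) * ρ (update x i g (E p 1)) *
          (ρ (update x i g (E p 2)))ᴴ * (ρ (update x i g (E p 3)))ᴴ).trace.re)) -
      (∑ p, (c - (ρ (update (update x j a) i g' (E p 0)) * ρ (update (update x j a) i g' (E p 1)) *
          (ρ (update (update x j a) i g' (E p 2)))ᴴ * (ρ (update (update x j a) i g' (E p 3)))ᴴ).trace.re)) +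
      (∑ p, (c - (ρ (update x i g' (E p 0)) * ρ (update x i g' (E p 1)) *
          (ρ (update x i g' (E p 2)))ᴴ * (ρ (update x i g' (E p 3)))ᴴ).trace.re))|
      ≤ Real.sqrt N * frobNorm (ρ g - ρ g') * frobNorm (ρ (x j) - ρ a) *
        ∑ p, (∑ k : Fin 4, if E p k = i then (1 : ℝ) else 0) *
          (∑ k : Fin 4, if E p k = j then (1 : ℝ) else 0) := by
  rw [← Finset.sum_sub_distrib, ← Finset.sum_sub_distrib, ← Finset.sum_add_distrib, Finset.mul_sum]
  refine (Finset.abs_sum_le_sum_abs _ _).trans (Finset.sum_le_sum fun p _ => ?_)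
  have h := abs_dd_word_le ρ hρu (E p) x hij a g g'
  have key : ∀ t1 t2 t3 t4 : ℝ, |c - t1 - (c - t2) - (c - t3) + (c - t4)| = |t1 - t2 - t3 + t4| :=
    fun t1 t2 t3 t4 => by
      rw [← abs_neg]; congr 1; ring
  rw [key]
  refine h.trans (le_of_eq ?_)
  ring

end Words

end Lattice

end Summit.QuantumFields.YangMills.Theorems.StrongPinningPoincare

end
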